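import Summits.Ventures.YMGap.RobustBall.RobustAreaLawOnBall
import Summits.Ventures.YMGap.RobustBall.RobustSlabDoorClustering
import Summits.Ventures.YMGap.RobustBall.TorusOneLink
import Summits.Ventures.YMGap.SlabAreaLawDimensions
import HarnessLib

/-!
# Robust ball (Y2), area-law side, part 6 — `AreaLawOnBall` from a one-link modulus: reading the door's loads off the ball

HONEST FRAMING: venture file of the cell `pub-ymgap` (QuantumFields programme), track ROBUST-BALL.  THE BOOKKEEPING that closes the
area-law chain: for a member `W` of rb-theory's tier-1 ball `ClusterDomainFR ε₀ ε₁ r` (finite range `r`, per-link oscillation load `≤ ε₀`,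
self + cross Lipschitz load `≤ ε₁`, witnessed by a `LoadWitness`), the abstract data of the robust slab door (`RobustSlabDoor`,
`RobustSlabDoorClustering`) for the total perturbation `W.total` are supplied: neighbourhoods of slice graph-radius `n·r`, oscillation
`δ = ε₀`, self-Lipschitz `ℓ = ε₁`, cross-Lipschitz coefficients `Λ(x̄,ȳ) = crossLip(e_x̄, e_ȳ)` with row bound `ε₁`.  Result:
`areaLawOnBall_of_oneLinkKRModulus`: a one-link modulus `OneLinkKRModulus N R K` on the slab ball `R ≥ 2n|β/N|` and the explicit row condition
`e^{ε₀}(1 + 2√N ε₁)·2n|β/N|K + √N ε₁ < 1` give `AreaLawOnBall N (n+1) β ε₀ ε₁ r mv` for every vertical diameter `mv ≥ 1` — Wilson's AREA LAW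
for the loop expectation under EVERY member's measure, constants uniform on the ball.  (The vertex bound `ℓ = Λ₀ = ε₁` is the simple lossy
form of DESIGN §6; the affine-vertex refinement is not done here.)  Strong-coupling finite-lattice statement; nothing about the continuum,
a mass gap, or Clay.
-/

noncomputable section

open MeasureTheory ProbabilityTheory
open Literature.Probability.LatticeModels hiding glue
open Literature.Probability.LatticeModels.DobrushinMetric
open Literature.MathematicalPhysics.QuantumLattice (fundamentalRep continuous_fundamentalRep fundamentalRep_apply)
open Literature.MathematicalPhysics.QuantumFieldTheory
open Literature.MathematicalPhysics.QuantumFieldTheory.DurhuusFrohlich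
open Literature.MathematicalPhysics.QuantumFieldTheory.Balaban1983to89.StrongCouplingDobrushinWindow (OneLinkKRModulus)

namespace Summit.Ventures.YMGap.RobustBall

variable {n L N : ℕ} [NeZero L]

/-! ### Geometry: the vertical link over a slice site; polymers through it stay within slice distance `n·r` -/

section Geometry

/-- The vertical link of the slab `{x_v = t}` over the slice site `x̄`. [folklore] -/
abbrev vlinkAt (v : Fin (n + 1)) (t : ZMod L) (x : TorusSite n L) : Edge (n + 1) L := (ins v t x, v)

omit [NeZero L] in
/-- A slab edge over `ȳ` whose base is `ins v t ȳ`: recovering the slice site. [folklore] -/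
theorem eq_vlinkAt_of_isSlab {v : Fin (n + 1)} {t : ZMod L} {e : Edge (n + 1) L} (h : IsSlab v t e) :
    e = vlinkAt v t (rem v e.1) := by
  obtain ⟨y, k⟩ := e
  obtain ⟨hk, hy⟩ := h
  simp only at hk hy
  subst hk; subst hy
  exact Prod.ext (ins_rem _ y).symm rfl

omit [NeZero L] in
/-- Two vertical links of one slab inside a polymer of `ℓ∞`-diameter `≤ r` have slice graph distance `≤ n·r`. [folklore] -/
theorem torusGraphDist_le_of_mem_polymer {v : Fin (n + 1)} {t : ZMod L} {X : Finset (Site (n + 1) L)} {r : ℕ}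
    (hX : polymerDiam X ≤ r) {x y : TorusSite n L} (hx : ins v t x ∈ X) (hy : ins v t y ∈ X) :
    torusGraphDist x y ≤ n * r := by
  classical
  have hdiam : torusNorm (ins v t x - ins v t y) ≤ r := by
    refine le_trans ?_ hX
    unfold polymerDiam
    exact le_trans (Finset.le_sup (f := fun y' => torusNorm (ins v t x - y')) hy)
      (Finset.le_sup (f := fun x' => X.sup fun y' => torusNorm (x' - y')) hx)
  have hk : ∀ k : Fin n, ((x k - y k).valMinAbs).natAbs ≤ r := by
    intro k
    have h := natAbs_valMinAbs_le_torusNorm (ins v t x - ins v t y) (v.succAbove k)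
    have hc : (ins v t x - ins v t y) (v.succAbove k) = x k - y k := by simp [ins]
    rw [hc] at h
    exact h.trans hdiam
  unfold torusGraphDist
  calc ∑ k, ((x k - y k).valMinAbs).natAbs ≤ ∑ _k : Fin n, r := Finset.sum_le_sum fun k _ => hk k
    _ = n * r := by simp

/-- Neighbours in the slab are at slice graph distance `≤ 1`. [folklore] -/
theorem torusGraphDist_le_one_of_mem_slabNbr {z w : TorusSite n L} (hw : w ∈ Slab.slabNbr z) : torusGraphDist z w ≤ 1 := by
  by_cases hzw : z = w
  · subst hzw; simp
  · have h := Slab.torusGraphDist_profile w z hzw w hw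
    simpa using h

end Geometry

/-! ### The door data of a member of the ball -/

section Loads

variable {v : Fin (n + 1)} {t : ZMod L} (W : Perturbation (n + 1) L N)
  (rr : {e : Edge (n + 1) L // ¬ IsSlab v t e} → SU N)

/-- The configuration seen by the site re-weighting: `glue (η^{x̄←g}) r`. [folklore] -/
abbrev cfg (v : Fin (n + 1)) (t : ZMod L) (rr : {e : Edge (n + 1) L // ¬ IsSlab v t e} → SU N)
    (x : TorusSite n L) (η : TorusSite n L → SU N) (g : SU N) : GaugeConfig (n + 1) L (SU N) :=
  glue v t (Function.update η x g) rr

omit [NeZero L] in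
/-- Changing the spin at `x̄` changes the configuration only at the vertical link over `x̄`. [folklore] -/
theorem cfg_eq_off_vlinkAt (x : TorusSite n L) (η : TorusSite n L → SU N) (g g' : SU N) (e : Edge (n + 1) L)
    (he : e ≠ vlinkAt v t x) : cfg v t rr x η g e = cfg v t rr x η g' e := by
  by_cases hs : IsSlab v t e
  · have hne : rem v e.1 ≠ x := fun h => he (by rw [eq_vlinkAt_of_isSlab hs, h])
    simp only [cfg, glue_of_isSlab _ _ _ _ hs, Function.update_of_ne hne]
  · simp only [cfg, glue_of_not_isSlab _ _ _ _ hs]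

omit [NeZero L] in
/-- The configuration at the vertical link over `x̄` is the inserted spin. [folklore] -/
theorem cfg_vlinkAt (x : TorusSite n L) (η : TorusSite n L → SU N) (g : SU N) : cfg v t rr x η g (vlinkAt v t x) = g := by
  simp [cfg]

omit [NeZero L] in
/-- Boundary conditions agreeing off `ȳ ≠ x̄` give configurations agreeing off the vertical link over `ȳ`. [folklore] -/
theorem cfg_eq_off_vlinkAt' (x y : TorusSite n L) {ω η : TorusSite n L → SU N} (h : ∀ z, z ≠ y → ω z = η z)
    (g : SU N) (e : Edge (n + 1) L) (he : e ≠ vlinkAt v t y) : cfg v t rr x ω g e = cfg v t rr x η g e := by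
  by_cases hs : IsSlab v t e
  · have hne : rem v e.1 ≠ y := fun h' => he (by rw [eq_vlinkAt_of_isSlab hs, h'])
    simp only [cfg, glue_of_isSlab _ _ _ _ hs]
    by_cases hx : rem v e.1 = x
    · rw [hx, Function.update_self, Function.update_self]
    · rw [Function.update_of_ne hx, Function.update_of_ne hx, h _ hne]
  · simp only [cfg, glue_of_not_isSlab _ _ _ _ hs]

omit [NeZero L] in
/-- The configuration at the vertical link over `ȳ ≠ x̄` is the boundary spin `ω ȳ`. [folklore] -/
theorem cfg_vlinkAt' (x y : TorusSite n L) (hyx : y ≠ x) (ω : TorusSite n L → SU N) (g : SU N) :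
    cfg v t rr x ω g (vlinkAt v t y) = ω y := by
  simp [cfg, Function.update_of_ne hyx]

/-- A term NOT reading the vertical link over `x̄` does not see the inserted spin. [folklore] -/
theorem act_cfg_eq_of_not_mem (x : TorusSite n L) (η : TorusSite n L → SU N) (g g' : SU N) {X : Finset (Site (n + 1) L)}
    (hX : vlinkAt v t x ∉ polymerEdges 1 X) : W.act X (cfg v t rr x η g) = W.act X (cfg v t rr x η g') :=
  W.dependsOn X fun e he => cfg_eq_off_vlinkAt rr x η g g' e (fun h => hX (h ▸ he))

/-- The site re-weighting of `W.total`, split into the terms through the vertical link over `x̄` and a `g`-independent rest. [folklore] -/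
theorem siteTiltW_total_eq (x : TorusSite n L) (η : TorusSite n L → SU N) (g : SU N) :
    siteTiltW v t W.total rr x η g =
      ∑ X ∈ polymersThroughEdge (vlinkAt v t x), W.act X (cfg v t rr x η g) +
        ∑ X ∈ (polymers (d := n + 1) (L := L) 1).filter (fun X => vlinkAt v t x ∉ polymerEdges 1 X),
          W.act X (cfg v t rr x η 1) := by
  classical
  rw [siteTiltW, QuasiLocalGaugePerturbation.total, polymersThroughEdge,
    ← Finset.sum_filter_add_sum_filter_not (polymers 1) (fun X => vlinkAt v t x ∈ polymerEdges 1 X)]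
  congr 1
  exact Finset.sum_congr rfl fun X hX => act_cfg_eq_of_not_mem W rr x η g 1 (Finset.mem_filter.1 hX).2

variable (v t) in
/-- The `W`-neighbourhood of a slice site: the other slice sites within graph distance `n·r`. [folklore] -/
def nbrBall (r : ℕ) (x : TorusSite n L) : Finset (TorusSite n L) :=
  Finset.univ.filter fun y => y ≠ x ∧ torusGraphDist x y ≤ n * r

/-- No site is in its own `W`-neighbourhood. [folklore] -/
theorem not_mem_nbrBall (r : ℕ) (x : TorusSite n L) : x ∉ nbrBall (n := n) (L := L) r x := by
  simp [nbrBall]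

/-- Neighbourhood range: `slabNbr ∪ nbrBall r` lies within slice graph distance `max(n·r, 1)`. [folklore] -/
theorem dist_le_of_mem_nbr (r : ℕ) (z w : TorusSite n L) (hw : w ∈ Slab.slabNbr z ∪ nbrBall (n := n) (L := L) r z) :
    torusGraphDist z w ≤ max (n * r) 1 := by
  rcases Finset.mem_union.1 hw with h | h
  · exact (torusGraphDist_le_one_of_mem_slabNbr h).trans (le_max_right _ _)
  · simp only [nbrBall, Finset.mem_filter, Finset.mem_univ, true_and] at h
    exact h.2.trans (le_max_left _ _)

/-- **Finite range ⇒ (hdep)**: boundary conditions agreeing on `slabNbr x̄ ∪ nbrBall r x̄` give site re-weightings differing by a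
`g`-independent constant. [folklore] -/
theorem siteTiltW_total_dep {r : ℕ} (hr : HasRange r W) (x : TorusSite n L) (η η' : TorusSite n L → SU N)
    (h : ∀ z ∈ Slab.slabNbr x ∪ nbrBall (n := n) (L := L) r x, η z = η' z) :
    ∃ c : ℝ, ∀ g, siteTiltW v t W.total rr x η g = c + siteTiltW v t W.total rr x η' g := by
  classical
  refine ⟨(∑ X ∈ (polymers (d := n + 1) (L := L) 1).filter (fun X => vlinkAt v t x ∉ polymerEdges 1 X),
      W.act X (cfg v t rr x η 1)) -
    ∑ X ∈ (polymers (d := n + 1) (L := L) 1).filter (fun X => vlinkAt v t x ∉ polymerEdges 1 X),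
      W.act X (cfg v t rr x η' 1), fun g => ?_⟩
  rw [siteTiltW_total_eq, siteTiltW_total_eq]
  have hthrough : ∀ X ∈ polymersThroughEdge (vlinkAt v t x), W.act X (cfg v t rr x η g) = W.act X (cfg v t rr x η' g) := by
    intro X hX
    rw [polymersThroughEdge, Finset.mem_filter] at hX
    rcases lt_or_ge r (polymerDiam X) with hdiam | hdiam
    · rw [hr X hdiam]; rfl
    · refine W.dependsOn X fun e he => ?_
      by_cases hs : IsSlab v t e
      · have hey : e = vlinkAt v t (rem v e.1) := eq_vlinkAt_of_isSlab hs
        set y := rem v e.1 with hy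
        by_cases hyx : y = x
        · rw [hey, hyx, cfg_vlinkAt, cfg_vlinkAt]
        · rw [hey, cfg_vlinkAt' rr x y hyx, cfg_vlinkAt' rr x y hyx]
          refine h y (Finset.mem_union_right _ ?_)
          simp only [nbrBall, Finset.mem_filter, Finset.mem_univ, true_and]
          refine ⟨hyx, torusGraphDist_le_of_mem_polymer (v := v) (t := t) hdiam ?_ ?_⟩
          · exact mem_polymerEdges_one.1 hX.2
          · have := mem_polymerEdges_one.1 (Finset.mem_coe.1 he); rwa [hey] at this
      · simp only [cfg, glue_of_not_isSlab _ _ _ _ hs]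
  rw [Finset.sum_congr rfl hthrough]
  ring

/-- **(hδ)**: the oscillation of the site re-weighting of `W.total` in the spin is at most the oscillation load at the vertical link.
[folklore] -/
theorem siteTiltW_total_osc (w : LoadWitness W) (x : TorusSite n L) (ω : TorusSite n L → SU N) (g g' : SU N) :
    siteTiltW v t W.total rr x ω g - siteTiltW v t W.total rr x ω g' ≤ w.oscLoad 0 (vlinkAt v t x) := by
  classical
  rw [siteTiltW_total_eq, siteTiltW_total_eq, add_sub_add_right_eq_sub, ← Finset.sum_sub_distrib, LoadWitness.oscLoad]
  refine Finset.sum_le_sum fun X _ => ?_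
  rw [zero_mul, Real.exp_zero, one_mul]
  exact (le_abs_self _).trans ((w.osc_spec X).le (vlinkAt v t x) _ _ fun z hz => cfg_eq_off_vlinkAt rr x ω g g' z hz)

/-- **(hℓ')**: the site re-weighting of `W.total` is Lipschitz in the spin with constant the self-Lipschitz load at the vertical link.
[folklore] -/
theorem siteTiltW_total_lip (w : LoadWitness W) (x : TorusSite n L) (ω : TorusSite n L → SU N) (g g' : SU N) :
    |siteTiltW v t W.total rr x ω g - siteTiltW v t W.total rr x ω g'| ≤ w.selfLipLoad 0 (vlinkAt v t x) * suFrobDist g g' := by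
  classical
  rw [siteTiltW_total_eq, siteTiltW_total_eq, add_sub_add_right_eq_sub, ← Finset.sum_sub_distrib, LoadWitness.selfLipLoad,
    Finset.sum_mul]
  refine (Finset.abs_sum_le_sum_abs _ _).trans (Finset.sum_le_sum fun X _ => ?_)
  rw [zero_mul, Real.exp_zero, one_mul]
  have h := (w.lip_spec X).le (vlinkAt v t x) (cfg v t rr x ω g) (cfg v t rr x ω g')
    fun z hz => cfg_eq_off_vlinkAt rr x ω g g' z hz
  rwa [cfg_vlinkAt, cfg_vlinkAt] at h

/-- The cross-Lipschitz coefficients of the door, read off the witness: `Λ(x̄, ȳ) = ℓ(e_x̄, e_ȳ)` (`0` on the diagonal). [folklore] -/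
def crossCoeff (w : LoadWitness W) (v : Fin (n + 1)) (t : ZMod L) (x y : TorusSite n L) : ℝ :=
  if y = x then 0 else w.crossLip 0 (vlinkAt v t x) (vlinkAt v t y)

/-- The door coefficients are nonnegative. [folklore] -/
theorem crossCoeff_nonneg (w : LoadWitness W) (x y : TorusSite n L) : 0 ≤ crossCoeff W w v t x y := by
  unfold crossCoeff; split_ifs
  · exact le_rfl
  · exact crossLip_nonneg w 0 _ _

/-- **(hΛ)**: changing the boundary spin at `ȳ` moves the site re-weighting at `x̄`, up to a `g`-independent constant, by at most
`Λ(x̄,ȳ)·‖ω_ȳ − η_ȳ‖_F`. [folklore] -/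
theorem siteTiltW_total_cross (w : LoadWitness W) (x y : TorusSite n L) {ω η : TorusSite n L → SU N}
    (h : ∀ z, z ≠ y → ω z = η z) :
    ∃ c : ℝ, ∀ g, |siteTiltW v t W.total rr x ω g - (c + siteTiltW v t W.total rr x η g)| ≤
      crossCoeff W w v t x y * suFrobDist (ω y) (η y) := by
  classical
  by_cases hyx : y = x
  · -- `ω = η` off `x̄`: the re-weightings coincide
    subst hyx
    refine ⟨0, fun g => ?_⟩
    have hcfg : cfg v t rr y ω g = cfg v t rr y η g := by
      have : Function.update ω y g = Function.update η y g := by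
        funext z; by_cases hz : z = y
        · subst hz; simp
        · rw [Function.update_of_ne hz, Function.update_of_ne hz, h z hz]
      simp only [cfg, this]
    simp only [siteTiltW, crossCoeff, if_true, zero_mul, zero_add]
    change |W.total (cfg v t rr y ω g) - W.total (cfg v t rr y η g)| ≤ 0
    rw [hcfg, sub_self, abs_zero]
  · refine ⟨(∑ X ∈ (polymers (d := n + 1) (L := L) 1).filter (fun X => vlinkAt v t x ∉ polymerEdges 1 X),
        W.act X (cfg v t rr x ω 1)) -
      ∑ X ∈ (polymers (d := n + 1) (L := L) 1).filter (fun X => vlinkAt v t x ∉ polymerEdges 1 X),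
        W.act X (cfg v t rr x η 1), fun g => ?_⟩
    rw [siteTiltW_total_eq, siteTiltW_total_eq]
    have halg : ∀ (a b c d : ℝ), a + c - (c - d + (b + d)) = a - b := fun a b c d => by ring
    rw [halg, ← Finset.sum_sub_distrib, crossCoeff, if_neg hyx, LoadWitness.crossLip, Finset.sum_mul]
    -- term by term: zero unless the polymer also reads the vertical link over `ȳ`, else the Lipschitz bound at that link
    rw [← Finset.sum_filter_add_sum_filter_not (polymersThroughEdge (vlinkAt v t x))
      (fun X => vlinkAt v t y ∈ polymerEdges 1 X)]
    have hzero : ∑ X ∈ (polymersThroughEdge (vlinkAt v t x)).filter (fun X => ¬ vlinkAt v t y ∈ polymerEdges 1 X),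
        (W.act X (cfg v t rr x ω g) - W.act X (cfg v t rr x η g)) = 0 := by
      refine Finset.sum_eq_zero fun X hX => ?_
      rw [sub_eq_zero]
      exact W.dependsOn X fun e he => cfg_eq_off_vlinkAt' rr x y h g e (fun h' => (Finset.mem_filter.1 hX).2 (h' ▸ he))
    rw [hzero, add_zero]
    refine (Finset.abs_sum_le_sum_abs _ _).trans (Finset.sum_le_sum fun X _ => ?_)
    rw [zero_mul, Real.exp_zero, one_mul]
    have hl := (w.lip_spec X).le (vlinkAt v t y) (cfg v t rr x ω g) (cfg v t rr x η g)
      fun z hz => cfg_eq_off_vlinkAt' rr x y h g z hz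
    rwa [cfg_vlinkAt' rr x y hyx, cfg_vlinkAt' rr x y hyx] at hl

omit [NeZero L] in
/-- `ins v t` is injective on slice sites (public copy of the tree's private lemma). [folklore] -/
theorem ins_injective' {v : Fin (n + 1)} {t : ZMod L} {a b : TorusSite n L} (h : ins v t a = ins v t b) : a = b := by
  funext k
  have := congrFun h (v.succAbove k)
  simpa [ins] using this

/-- **(hrow)**: the row sums of the door coefficients are bounded by the cross-Lipschitz load at the vertical link. [folklore] -/
theorem crossCoeff_rowsum_le (w : LoadWitness W) (r : ℕ) (x : TorusSite n L) :
    ∑ y ∈ Slab.slabNbr x ∪ nbrBall (n := n) (L := L) r x, crossCoeff W w v t x y ≤ w.crossLipLoad 0 (vlinkAt v t x) := by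
  classical
  have hdiag : crossCoeff W w v t x x = 0 := by simp [crossCoeff]
  have hinj : ∀ y ∈ Finset.univ.erase x, ∀ y' ∈ Finset.univ.erase x, vlinkAt v t y = vlinkAt v t y' → y = y' :=
    fun y _ y' _ hyy' => ins_injective' (congrArg Prod.fst hyy')
  calc ∑ y ∈ Slab.slabNbr x ∪ nbrBall (n := n) (L := L) r x, crossCoeff W w v t x y
      ≤ ∑ y ∈ Finset.univ, crossCoeff W w v t x y :=
        Finset.sum_le_sum_of_subset_of_nonneg (Finset.subset_univ _) fun y _ _ => crossCoeff_nonneg W w x y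
    _ = ∑ y ∈ Finset.univ.erase x, crossCoeff W w v t x y := by
        rw [← Finset.sum_erase_add _ _ (Finset.mem_univ x), hdiag, add_zero]
    _ = ∑ y ∈ Finset.univ.erase x, w.crossLip 0 (vlinkAt v t x) (vlinkAt v t y) :=
        Finset.sum_congr rfl fun y hy => by rw [crossCoeff, if_neg (Finset.ne_of_mem_erase hy)]
    _ = ∑ e ∈ (Finset.univ.erase x).image (vlinkAt v t), w.crossLip 0 (vlinkAt v t x) e := by
        rw [Finset.sum_image hinj]
    _ ≤ w.crossLipLoad 0 (vlinkAt v t x) := by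
        rw [LoadWitness.crossLipLoad]
        refine Finset.sum_le_sum_of_subset_of_nonneg (fun e he => ?_) fun e _ _ => crossLip_nonneg w 0 _ _
        obtain ⟨y, hy, rfl⟩ := Finset.mem_image.1 he
        exact Finset.mem_erase.2
          ⟨fun h => Finset.ne_of_mem_erase hy (ins_injective' (congrArg Prod.fst h)), Finset.mem_univ _⟩

end Loads

/-! ### The ball area law from a one-link modulus -/

section Ball

/-- **AREA LAW ON THE BALL FROM A ONE-LINK MODULUS (explicit row condition).**  Let `N ≥ 2`, `β` the tree coupling ('t Hooft `β/N`),
`OneLinkKRModulus N R K` a one-link Kantorovich–Rubinstein modulus on the slab ball `R ≥ 2n|β/N|`, `0 ≤ ε₁`, a range `r`, a vertical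
diameter `mv ≥ 1`, and suppose the ROW CONDITION `e^{ε₀}(1 + 2√N ε₁)·(2n|β/N|K) + √N ε₁ < 1`.  Then `AreaLawOnBall N (n+1) β ε₀ ε₁ r mv`:
there are `C, c > 0` such that for every torus `L`, every `W ∈ ClusterDomainFR ε₀ ε₁ r` with `IsSlabLocal mv W` and every rectangular `R×T`
loop with `2R, 2T ≤ L`, `|⟨W_{R×T}⟩_{μ_{β,W,L}}| ≤ C^{2(R+T)} e^{-cRT}`.  Chain: door data of the member (`siteTiltW_total_*`) → robust slab door
(`slabLawW_entry_cov_le`) → robust Durhuus–Fröhlich criterion (`areaLawOnBall_of_slabCovariance`). [cite: CaoNissimSheffield2025dynamical, Theorem 2.3] -/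
theorem slabCovariance_of_oneLinkKRModulus (hN : 1 ≤ N) (βt : ℝ) {R K : ℝ} (hK : 0 ≤ K) (hmod : OneLinkKRModulus N R K)
    (hR : |βt| * (2 * (n : ℝ)) ≤ R) {ε₀ ε₁ : ℝ} (h₁ : 0 ≤ ε₁) (r mv : ℕ)
    (hc : Real.exp ε₀ * (1 + 2 * Real.sqrt N * ε₁) * (2 * (n : ℝ) * |βt| * K) + Real.sqrt N * ε₁ ≤ 1)
    (L : ℕ) [NeZero L] (W : Perturbation (n + 1) L N) (hWball : W ∈ ClusterDomainFR ε₀ ε₁ r) (_hWloc : IsSlabLocal mv W)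
    (v : Fin (n + 1)) (t : ZMod L) (rest : {e : Edge (n + 1) L // ¬ IsSlab v t e} → SU N) (x y : Site n L)
    (i j k l : Fin N) (φ ψ : ℂ → ℝ) (hφ : φ = Complex.re ∨ φ = Complex.im) (hψ : ψ = Complex.re ∨ ψ = Complex.im) :
    |cov[fun Q => φ ((Q x : Matrix (Fin N) (Fin N) ℂ) i j),
        fun Q => ψ ((((Q y)⁻¹ : Matrix.specialUnitaryGroup (Fin N) ℂ) : Matrix (Fin N) (Fin N) ℂ) k l);
        slabLawW v t βt W.total rest]| ≤
      8 * N * (max (Real.exp ε₀ * (1 + 2 * Real.sqrt N * ε₁) * (2 * (n : ℝ) * |βt| * K) + Real.sqrt N * ε₁) (1 / 2))⁻¹ *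
        Real.exp (-(-Real.log (max (Real.exp ε₀ * (1 + 2 * Real.sqrt N * ε₁) * (2 * (n : ℝ) * |βt| * K) + Real.sqrt N * ε₁)
          (1 / 2)) / (max (n * r) 1 : ℕ)) * torusGraphDist x y) := by
  classical
  obtain ⟨hrange, w, hosc, hlip⟩ := hWball
  have hsl : ∀ e, w.selfLipLoad 0 e ≤ ε₁ := fun e =>
    le_trans (le_add_of_nonneg_right (Finset.sum_nonneg fun y _ => crossLip_nonneg w 0 e y)) (hlip e)
  have hcl : ∀ e, w.crossLipLoad 0 e ≤ ε₁ := fun e =>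
    le_trans (le_add_of_nonneg_left (Finset.sum_nonneg fun X _ =>
      mul_nonneg (Real.exp_pos _).le ((w.lip_spec X).nonneg e))) (hlip e)
  exact slabLawW_entry_cov_le (n := n) (L := L) (N := N) (W := W.total) hN v t (β := βt) (R := R) (K := K)
    (δ := ε₀) (ℓ := ε₁) (Λ₀ := ε₁) hK h₁ hR hmod W.measurable_total W.exists_abs_total_le rest (nbrBall r)
    (not_mem_nbrBall r) (fun x' η η' h => siteTiltW_total_dep W rest hrange x' η η' h)
    (fun x' ω g g' => (siteTiltW_total_osc W rest w x' ω g g').trans (hosc _))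
    (fun x' ω g g' => (siteTiltW_total_lip W rest w x' ω g g').trans
      (mul_le_mul_of_nonneg_right (hsl _) (suFrobDist_nonneg _ _)))
    (crossCoeff W w v t) (fun x' y' => crossCoeff_nonneg W w x' y')
    (fun x' y' ω η h => siteTiltW_total_cross W rest w x' y' h)
    (fun x' => (crossCoeff_rowsum_le W w r x').trans (hcl _)) hc (le_max_right _ _)
    (fun z w' hw' => dist_le_of_mem_nbr r z w' hw') x y i j k l φ ψ hφ hψ

/-- **AREA LAW ON THE BALL FROM A ONE-LINK MODULUS (explicit row condition).**  Let `N ≥ 2`, `β` the tree coupling ('t Hooft `β/N`),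
`OneLinkKRModulus N R K` a one-link Kantorovich–Rubinstein modulus on the slab ball `R ≥ 2n|β/N|`, `0 ≤ ε₁`, a range `r`, a vertical
diameter `mv ≥ 1`, and suppose the ROW CONDITION `e^{ε₀}(1 + 2√N ε₁)·(2n|β/N|K) + √N ε₁ < 1`.  Then `AreaLawOnBall N (n+1) β ε₀ ε₁ r mv`:
there are `C, c > 0` such that for every torus `L`, every `W ∈ ClusterDomainFR ε₀ ε₁ r` with `IsSlabLocal mv W` and every rectangular `R×T`
loop with `2R, 2T ≤ L`, `|⟨W_{R×T}⟩_{μ_{β,W,L}}| ≤ C^{2(R+T)} e^{-cRT}`.  Chain: door data of the member (`siteTiltW_total_*`) → robust slab door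
(`slabLawW_entry_cov_le`) → robust Durhuus–Fröhlich criterion (`areaLawOnBall_of_slabCovariance`). [cite: CaoNissimSheffield2025dynamical, Theorem 2.3] -/
theorem areaLawOnBall_of_oneLinkKRModulus (hN : 2 ≤ N) (β : ℝ) {R K : ℝ} (hK : 0 ≤ K) (hmod : OneLinkKRModulus N R K)
    (hR : |β / N| * (2 * (n : ℝ)) ≤ R) {ε₀ ε₁ : ℝ} (h₁ : 0 ≤ ε₁) (r : ℕ) {mv : ℕ} (hmv : 1 ≤ mv)
    (hc : Real.exp ε₀ * (1 + 2 * Real.sqrt N * ε₁) * (2 * (n : ℝ) * |β / N| * K) + Real.sqrt N * ε₁ < 1) :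
    AreaLawOnBall N (n + 1) β ε₀ ε₁ r mv :=
  areaLawOnBall_of_slabCovariance (n := n) hN β ε₀ ε₁ r hmv (doorRate_pos hc (le_max_right (n * r) 1))
    fun L _ W hWball hWloc v t rest x y i j k l φ ψ hφ hψ =>
      slabCovariance_of_oneLinkKRModulus (by omega) (β / N) hK hmod hR h₁ r mv hc.le L W hWball hWloc v t rest x y
        i j k l φ ψ hφ hψ

end Ball

end Summit.Ventures.YMGap.RobustBall
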